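import Summits.QuantumAdvantage.AdviceFreeQNC0.AffBells35PolyLossOfWREL

/-!
# qa-qnc0-p1 g35 — `PolyLossOfWREL` and the wired-elimination line, part 2/7: the firing lemma (bookkeeping half of `ComponentElimination`) and `ComponentSilenceMass ⟸ TypicalMass ∧ TypicalPerfectQuiet`

Continuation of `AffBells35PolyLossOfWREL`.

Ported to the tree VERBATIM (split into seven files `AffBells35PolyLossOfWREL` / `AffBells35WREL{Firing,Quiet,Typical,Structure,Twins,Toggle}` for the 400-line rule; lint fixes only: `push Not`, `card_filter_add_card_filter_not`, unused simp arguments, two `_`-binders) by the prover seat qn-prover-3 g20 at the ask of planner qa-qnc0-p1 g36 (INBOX 11:15Z: exp35/WREL35.lean FROZEN, 1891 l., farm rc 0 / 0 sorry); authored and proved by the planner seat qa-qnc0-p1 g35.  Serves the crux stmt-QuantumAdvantage-22907 (route DWalkThree); untagged (the gate refuses `--supports` across sub-problems on AdviceFreeQNC0/ targets).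
-/

noncomputable section
open Classical

namespace Summit.QuantumAdvantage.AdviceFreeQNC0.AffBells35

open Finset Literature.Computability.QuantumComplexity Literature.Computability.QuantumComplexity.RingHLF
open AffBells23 Fib19 AffBells26 AffBells29

variable {N : ℕ}

/-! ### Bookkeeping half of `ComponentElimination` (ROUND-34 §12.12(b),(u)): the FIRING LEMMA, proved.
Fired rows always answer `true`; so firing `K` changes `activeOnes` by the number of QUIET rows (active `K`-rows that did not fire), and by
`targetFormula` the outcome at `x` is unchanged whenever that number is even.  Hence the new imperfect fibres lie in the old ones or in the
NOISY fibres of `K` (some odd input of the fibre has an odd quiet count), and `ComponentElimination` reduces to a pure mass statement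
`ComponentSilenceMass` about noisy-but-perfect fibres — the Fourier/typicality heart (dualSZDecoupling + P-38aa). -/

/-- number of QUIET rows of `K` at `x`: active rows of `K` whose bell does not fire. -/
def quietCount (β : Fin N → Fin N → ZMod 3) (c : Fin N → ZMod 3) (K : Finset (Fin N)) (x : Fin N → Bool) : ℕ :=
  (univ.filter fun h => h ∈ K ∧ kline x h = true ∧ affBell β c x h = false).card

/-- `affBell_fire` (planner qa-qnc0-p1 g35, exp35/WREL35.lean; see the section header above). -/
theorem affBell_fire (β : Fin N → Fin N → ZMod 3) (c : Fin N → ZMod 3) (K : Finset (Fin N)) (x : Fin N → Bool) (h : Fin N) :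
    affBell (fireRows β K) (fireRes c K) x h = if h ∈ K then true else affBell β c x h := by
  unfold affBell fireRows fireRes
  by_cases hK : h ∈ K
  · simp [hK]
  · simp [hK]

/-- `activeOnes_fire` (planner qa-qnc0-p1 g35, exp35/WREL35.lean; see the section header above). -/
theorem activeOnes_fire (β : Fin N → Fin N → ZMod 3) (c : Fin N → ZMod 3) (K : Finset (Fin N)) (x : Fin N → Bool) :
    activeOnes x (affBell (fireRows β K) (fireRes c K) x) = activeOnes x (affBell β c x) + quietCount β c K x := by
  simp only [activeOnes, quietCount, Finset.card_filter]
  rw [← Finset.sum_add_distrib]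
  refine Finset.sum_congr rfl fun h _ => ?_
  rw [affBell_fire]
  by_cases hK : h ∈ K <;> by_cases ha : kline x h = true <;> by_cases hf : affBell β c x h = true <;> simp [hK, ha, hf]

/-- **FIRING LEMMA**: if the quiet count of `K` at the odd input `x` is even, firing `K` does not change the outcome at `x`. -/
theorem rel_fire_iff (hN : 3 ≤ N) (β : Fin N → Fin N → ZMod 3) (c : Fin N → ZMod 3) (K : Finset (Fin N))
    (x : Fin N → Bool) (hodd : IsOdd x) (hq : quietCount β c K x % 2 = 0) :
    RingHLF.Rel x (affBell (fireRows β K) (fireRes c K) x) ↔ RingHLF.Rel x (affBell β c x) := by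
  rw [targetFormula N hN x hodd, targetFormula N hN x hodd, activeOnes_fire]
  constructor <;> intro h <;> omega

/-- NOISY fibres of `K`: odd inputs whose fibre contains an odd input with an odd quiet count. -/
def noisyFibres (β : Fin N → Fin N → ZMod 3) (c : Fin N → ZMod 3) (K : Finset (Fin N)) : Finset (Fin N → Bool) :=
  univ.filter fun x => IsOdd x ∧ ∃ x' : Fin N → Bool, IsOdd x' ∧ kline x' = kline x ∧ quietCount β c K x' % 2 = 1

/-- `imperfectFibres_fire_subset` (planner qa-qnc0-p1 g35, exp35/WREL35.lean; see the section header above). -/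
theorem imperfectFibres_fire_subset (hN : 3 ≤ N) (β : Fin N → Fin N → ZMod 3) (c : Fin N → ZMod 3) (K : Finset (Fin N)) :
    imperfectFibres (fireRows β K) (fireRes c K) ⊆ imperfectFibres β c ∪ noisyFibres β c K := by
  intro x hx
  simp only [imperfectFibres, ImperfectAt, mem_filter, mem_univ, true_and] at hx
  obtain ⟨hodd, x', hodd', hk, hnrel⟩ := hx
  rw [mem_union]
  by_cases hq : quietCount β c K x' % 2 = 0
  · left
    exact mem_filter.2 ⟨mem_univ _, hodd, x', hodd', hk, fun hrel => hnrel ((rel_fire_iff hN β c K x' hodd' hq).2 hrel)⟩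
  · right
    exact mem_filter.2 ⟨mem_univ _, hodd, x', hodd', hk, by omega⟩

/-- `card_imperfectFibres_fire_le` (planner qa-qnc0-p1 g35, exp35/WREL35.lean; see the section header above). -/
theorem card_imperfectFibres_fire_le (hN : 3 ≤ N) (β : Fin N → Fin N → ZMod 3) (c : Fin N → ZMod 3) (K : Finset (Fin N)) :
    (imperfectFibres (fireRows β K) (fireRes c K)).card
      ≤ (imperfectFibres β c).card + (noisyFibres β c K \ imperfectFibres β c).card := by
  calc (imperfectFibres (fireRows β K) (fireRes c K)).card
      ≤ (imperfectFibres β c ∪ noisyFibres β c K).card := card_le_card (imperfectFibres_fire_subset hN β c K)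
    _ = (imperfectFibres β c ∪ (noisyFibres β c K \ imperfectFibres β c)).card := by rw [union_sdiff_self_eq_union]
    _ ≤ (imperfectFibres β c).card + (noisyFibres β c K \ imperfectFibres β c).card := card_union_le _ _

/-- **P-38al `ComponentSilenceMass` (M/L; the Fourier + typicality heart of CE).**  For every level `e` there are radii such that, for the
light-free position component `K` of any row, the PERFECT-but-NOISY fibres of `K` have mass `≤ 2^{N−1}/N^{e+2}`.  Proof plan: a typical perfect
fibre is quiet — on it every coin-`D`-component of active exponents meeting `K` is inside `K` and `D`-wide (typicality, P-38aa), so its pair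
sum vanishes on the parity coset by `dualSZDecoupling` applied to the fibre identity (bell `= 1 +` pair), i.e. the quiet count is even at
every input of the fibre; the atypical mass is `≤ 2^{N−1}/N^{e+2}`. -/
def ComponentSilenceMass : Prop :=
  ∀ e : ℕ, ∃ C₁ C₂ n₀ : ℕ, ∀ N ≥ n₀, ∀ (β : Fin N → Fin N → ZMod 3) (c : Fin N → ZMod 3) (b : Fin N),
    (∀ g ∈ posComponent (C₁ * Nat.log 2 N) β b, C₂ * Nat.log 2 N ≤ (rowSupp β g).card) →
    (noisyFibres β c (posComponent (C₁ * Nat.log 2 N) β b) \ imperfectFibres β c).card * N ^ (e + 2) ≤ 2 ^ (N - 1)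

/-- **CE from its heart:** `ComponentSilenceMass → ComponentElimination` (the bookkeeping is done). -/
theorem ce_of_silenceMass (h : ComponentSilenceMass) : ComponentElimination := by
  intro e
  obtain ⟨C₁, C₂, n₀, h⟩ := h e
  refine ⟨C₁, C₂, max n₀ 3, fun N hN β c b hlf => ?_⟩
  have hN3 : 3 ≤ N := le_trans (le_max_right _ _) hN
  have h1 := card_imperfectFibres_fire_le hN3 β c (posComponent (C₁ * Nat.log 2 N) β b)
  have h2 := h N (le_trans (le_max_left _ _) hN) β c b hlf
  calc (imperfectFibres (fireRows β (posComponent (C₁ * Nat.log 2 N) β b)) (fireRes c (posComponent (C₁ * Nat.log 2 N) β b))).card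
          * N ^ (e + 2)
      ≤ ((imperfectFibres β c).card + (noisyFibres β c (posComponent (C₁ * Nat.log 2 N) β b) \ imperfectFibres β c).card)
          * N ^ (e + 2) := Nat.mul_le_mul_right _ h1
    _ = (imperfectFibres β c).card * N ^ (e + 2)
          + (noisyFibres β c (posComponent (C₁ * Nat.log 2 N) β b) \ imperfectFibres β c).card * N ^ (e + 2) := by ring
    _ ≤ (imperfectFibres β c).card * N ^ (e + 2) + 2 ^ (N - 1) := by omega

/-- **Corollary (the formal line, closing form):** `ComponentSilenceMass → WiredElimination → AffBellsPolyLoss3`. -/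
theorem polyLoss_of_silenceMass_wired (h₁ : ComponentSilenceMass) (h₂ : WiredElimination) : AffBellsPolyLoss3 :=
  polyLoss_of_split' (ce_of_silenceMass h₁) h₂


/-! ### The heart split once more: `ComponentSilenceMass ⟸ TypicalMass ∧ TypicalPerfectQuiet` (ROUND-34 §12.12(u)).
`TypicalAt R D W β x` (a property of the fibre `kline x`): rows that are NOT position-near at radius `R` are at COIN distance `≥ D` on this
fibre (both for `β_g` vs `β_h` and `β_g` vs `2β_h`), and rows of width `≥ W` have `≥ D` coins in their support.  `TypicalMass` (P-38am,
probability: hard-core large deviations, cf. P-38aa) bounds the atypical mass; `TypicalPerfectQuiet` (P-38an, deterministic: the fibre identity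
+ `dualSZDecoupling`, uniformly in `R, W`) says a typical PERFECT fibre is quiet for every light-free position component. -/

/-- the dual Schwartz–Zippel scale: `9(2N+1)²(N+1)² < 2^D` holds for `D = dScale N` (`m ≤ 2N` exponents, `z ≤ N` coins). -/
def dScale (N : ℕ) : ℕ := 4 * Nat.log 2 N + 16

/-- coin distance of two forms on the fibre of `x` (coins = `kline x = false`). -/
def coinDist (_β : Fin N → Fin N → ZMod 3) (x : Fin N → Bool) (v w : Fin N → ZMod 3) : ℕ :=
  (univ.filter fun i => kline x i = false ∧ v i ≠ w i).card

/-- TYPICAL fibre (through its input `x`) at position radius `R`, coin scale `D`, width threshold `W`. -/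
def TypicalAt (R D W : ℕ) (β : Fin N → Fin N → ZMod 3) (x : Fin N → Bool) : Prop :=
  (∀ g h : Fin N, ¬ NearRows R β g h →
      D ≤ coinDist β x (β g) (β h) ∧ D ≤ coinDist β x (β g) (fun i => 2 * β h i)) ∧
  (∀ g : Fin N, W ≤ (rowSupp β g).card → D ≤ coinDist β x (β g) (fun _ => 0))

/-- atypical odd inputs. -/
def atypical (R D W : ℕ) (β : Fin N → Fin N → ZMod 3) : Finset (Fin N → Bool) :=
  univ.filter fun x => IsOdd x ∧ ¬ TypicalAt R D W β x

/-- **P-38am `TypicalMass` (M; probability).**  For every level `e`, radii `C₁ log₂N`, `C₂ log₂N` make the atypical mass `≤ 2^{N−1}/N^{e+2}`: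
under the hard-core measure of `kline x` (odd `x` uniform), a fixed set of `≥ C log₂ N` positions contains `< 4log₂N + 16` coins with
probability `N^{−Ω(C)}` (coins have density `≥ 1/4 − o(1)` along any position set, with exponential concentration — the chain-domination /
transfer-matrix estimate of P-38aa), and a union bound over `≤ 2N² + N` events. -/
def TypicalMass : Prop :=
  ∀ e : ℕ, ∃ C₁ C₂ n₀ : ℕ, ∀ N ≥ n₀, ∀ (β : Fin N → Fin N → ZMod 3),
    (atypical (C₁ * Nat.log 2 N) (dScale N) (C₂ * Nat.log 2 N) β).card * N ^ (e + 2) ≤ 2 ^ (N - 1)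

/-- **P-38an `TypicalPerfectQuiet` (M; deterministic — the fibre identity + `dualSZDecoupling`).**  On a typical PERFECT fibre, every
light-free position component `K` is quiet at every input of the fibre (even quiet count).  Uniform in the radii `R, W`.  Proof: write
`[⟨β_h,x⟩ = c_h] = 1 + ω^{2c′_h}χ_{w_h}(u) + ω^{c′_h}χ_{2w_h}(u)` over `𝔽₄ ⊂ F` (`w_h = β_h|_coins`, `u` = coins of `x`, `c′_h` = residual
target); perfectness + `targetFormula` make the total pair sum constant on the parity coset (`holoSum ≡ κ`); the coin-`dScale N`-components of
the active exponents that meet `K` lie inside `K` (typicality (1) + closure of `K` under `NearRows`) and are `dScale N`-wide (typicality (2)),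
so each vanishes on the coset by `dualSZDecoupling` (`9(2N+1)²(N+1)² < 2^{dScale N}`); summing, `#fired + #active ≡ 0` on `K`. -/
def TypicalPerfectQuiet : Prop :=
  ∃ n₀ : ℕ, ∀ N ≥ n₀, ∀ (R W : ℕ) (β : Fin N → Fin N → ZMod 3) (c : Fin N → ZMod 3) (b : Fin N) (x : Fin N → Bool),
    IsOdd x → TypicalAt R (dScale N) W β x →
    (∀ g ∈ posComponent R β b, W ≤ (rowSupp β g).card) →
    PerfectFibre β c (kline x) →
    ∀ x' : Fin N → Bool, IsOdd x' → kline x' = kline x → quietCount β c (posComponent R β b) x' % 2 = 0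

/-- `perfectFibre_of_not_imperfectAt` (planner qa-qnc0-p1 g35, exp35/WREL35.lean; see the section header above). -/
theorem perfectFibre_of_not_imperfectAt (β : Fin N → Fin N → ZMod 3) (c : Fin N → ZMod 3) (x : Fin N → Bool)
    (h : ¬ ImperfectAt β c x) : PerfectFibre β c (kline x) := by
  intro x' hodd' hk
  by_contra hrel
  exact h ⟨x', hodd', hk, hrel⟩

/-- **The heart from its two halves:** `TypicalMass → TypicalPerfectQuiet → ComponentSilenceMass`. -/
theorem silenceMass_of_typical (hTM : TypicalMass) (hTQ : TypicalPerfectQuiet) : ComponentSilenceMass := by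
  intro e
  obtain ⟨C₁, C₂, n₀, hTM⟩ := hTM e
  obtain ⟨n₁, hTQ⟩ := hTQ
  refine ⟨C₁, C₂, max n₀ n₁, fun N hN β c b hlf => ?_⟩
  have hsub : noisyFibres β c (posComponent (C₁ * Nat.log 2 N) β b) \ imperfectFibres β c
      ⊆ atypical (C₁ * Nat.log 2 N) (dScale N) (C₂ * Nat.log 2 N) β := by
    intro x hx
    rw [mem_sdiff] at hx
    obtain ⟨hx, hni⟩ := hx
    simp only [noisyFibres, mem_filter, mem_univ, true_and] at hx
    obtain ⟨hodd, x', hodd', hk, hq⟩ := hx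
    refine mem_filter.2 ⟨mem_univ _, hodd, fun htyp => ?_⟩
    have hperf : PerfectFibre β c (kline x) := by
      refine perfectFibre_of_not_imperfectAt β c x fun him => hni ?_
      exact mem_filter.2 ⟨mem_univ _, hodd, him⟩
    have := hTQ N (le_trans (le_max_right _ _) hN) (C₁ * Nat.log 2 N) (C₂ * Nat.log 2 N) β c b x hodd htyp hlf hperf
      x' hodd' hk
    omega
  calc (noisyFibres β c (posComponent (C₁ * Nat.log 2 N) β b) \ imperfectFibres β c).card * N ^ (e + 2)
      ≤ (atypical (C₁ * Nat.log 2 N) (dScale N) (C₂ * Nat.log 2 N) β).card * N ^ (e + 2) :=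
        Nat.mul_le_mul_right _ (card_le_card hsub)
    _ ≤ 2 ^ (N - 1) := hTM N (le_trans (le_max_left _ _) hN) β

/-- **THE FORMAL LINE (g35 closing form):** `TypicalMass → TypicalPerfectQuiet → WiredElimination → AffBellsPolyLoss3`. -/
theorem polyLoss_of_three (h₁ : TypicalMass) (h₂ : TypicalPerfectQuiet) (h₃ : WiredElimination) : AffBellsPolyLoss3 :=
  polyLoss_of_silenceMass_wired (silenceMass_of_typical h₁ h₂) h₃



end Summit.QuantumAdvantage.AdviceFreeQNC0.AffBells35
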